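import Literature.Analysis.FluidPDE.TypeIAncientMild
import Literature.Analysis.FluidPDE.KNSSTypeIRateMildProofs
import Literature.Analysis.FluidPDE.KatoSymmetryCovariance
import Literature.Analysis.FluidPDE.KNSSOseenMildDecayTools
import HarnessLib

/-!
# The KNSS-gauge Type-I ancient mild class is invariant under the Navier–Stokes scaling

Analysis/FluidPDE proof file (theorems only: no definition, no named fact, no `sorry`).

`IsTypeIAncientMild C u` (`TypeIAncientMild.lean`): `u` is `C^∞` on `t < 0`, divergence free,
satisfies the Oseen–Duhamel identity between all pairs of negative times, and obeys the Type-I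
bound `|u(t, x)| ≤ C/√(−t)`. The Navier–Stokes scaling `u_c(t, x) = c u(c²t, c x)`
(`nsRescale c u`, `c > 0`; Leray 1934 §20, Koch–Nadirashvili–Seregin–Šverák 2009 §1 (1.2): "the
scaling symmetry `u(x,t) → λu(λx, λ²t)` of the equations") maps the class to itself WITH THE SAME
CONSTANT `C`:

* `IsTypeIAncientMild.nsRescale` — smoothness and divergence-freeness transport along the linear
  substitution, the Oseen–Duhamel identity by the parabolic covariance of the Oseen integral
  equation (`oseen_smul_stPull`, `KNSSTypeIRateMildProofs.lean`), the rate by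
  `HasTypeITimeDecay.nsRescale` (`C/√(−c²t) · c = C/√(−t)`).

* `IsTypeIAncientMild.comp_add_right` — the class is invariant under SPACE TRANSLATIONS
  `u ↦ u(·, · + a)` with the same constant (smoothness and the divergence condition are translation
  covariant, the heat flow and the Oseen–Duhamel term commute with translations —
  `heatFlow_comp_add_right`, `oseenDuhamel_comp_add_right` — and the Type-I bound is uniform in
  `x`); previously only in `Theorems/SymmetryModuliCountSymmetricLiouville.lean` (route cone).

The scaling statement was previously available only inside route-specific `Summits/` files
(`Theorems/SymmetryModuliCountFarPastLedgerReduction.lean`,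
`Theorems/FarPastLedger/Negative/Scaling.lean`, both in the cone of a route file); this is the
route-independent home, word for word the proof of the latter.

## References

* G. Koch, N. Nadirashvili, G. Seregin, V. Šverák, *Liouville theorems for the Navier–Stokes
  equations and applications*, Acta Math. 203 (2009) 83–105 = arXiv:0709.3599, §1 (1.2).
  [`KochNadirashviliSereginSverak2009`]
* J. Leray, Acta Math. 63 (1934), §20. [`Leray1934`]
-/

noncomputable section

open MeasureTheory Set Function Filter
open _root_.Topology
open scoped RealInnerProductSpace

namespace Literature.Analysis.FluidPDE

/-- `u_c(t,x) = c u(c²t, cx)` is the zoom `c • stPull c² c 0 0 u` of `ClassicalSolutionRescale` /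
`KNSSTypeIRateMildProofs`. [cite: KochNadirashviliSereginSverak2009, §1 (1.2)] -/
theorem nsRescale_eq_smul_stPull_zero (c : ℝ)
    (u : ℝ → EuclideanSpace ℝ (Fin 3) → EuclideanSpace ℝ (Fin 3)) :
    nsRescale c u = c • stPull (c ^ 2) c 0 0 u := by
  funext s y
  simp only [nsRescale_apply, Pi.smul_apply, stPull_apply, zero_add]

/-- **The KNSS-gauge Type-I ancient mild class is invariant under the parabolic scaling**
`u ↦ c u(c²t, cx)`, `c > 0`, with the SAME constant `C` (Koch–Nadirashvili–Seregin–Šverák 2009,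
§1 (1.2)): smoothness and divergence-freeness transport along the linear substitution, the Oseen
equation by `oseen_smul_stPull` (homogeneity of the Oseen kernel), the rate by
`HasTypeITimeDecay.nsRescale`. [cite: KochNadirashviliSereginSverak2009, §1 (1.2)] -/
theorem IsTypeIAncientMild.nsRescale {C : ℝ}
    {u : ℝ → EuclideanSpace ℝ (Fin 3) → EuclideanSpace ℝ (Fin 3)} (h : IsTypeIAncientMild C u)
    {c : ℝ} (hc : 0 < c) : IsTypeIAncientMild C (FluidPDE.nsRescale c u) := by
  have hc2 : 0 < c ^ 2 := pow_pos hc 2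
  refine ⟨?_, fun t ht => ?_, fun s t hst ht x => ?_, h.hasTypeITimeDecay.nsRescale hc⟩
  · have e : Function.uncurry (FluidPDE.nsRescale c u) =
        fun p : ℝ × EuclideanSpace ℝ (Fin 3) => c • Function.uncurry u (c ^ 2 * p.1, c • p.2) := by
      funext p; rfl
    rw [e]
    refine (h.contDiffOn.comp
      ((contDiff_const.mul contDiff_fst).prodMk (contDiff_snd.const_smul c)).contDiffOn
      fun p hp => ?_).const_smul c
    have hp1 : p.1 < 0 := hp.1
    exact mk_mem_prod (mul_neg_of_pos_of_neg hc2 hp1) (mem_univ _)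
  · have hct : c ^ 2 * t < 0 := mul_neg_of_pos_of_neg hc2 ht
    have hd : VectorCalculus.IsDivFree (fun x : EuclideanSpace ℝ (Fin 3) => u (c ^ 2 * t) (c • x)) :=
      (h.isDivFree hct).comp_smul c
    have hdiff : Differentiable ℝ (fun x : EuclideanSpace ℝ (Fin 3) => u (c ^ 2 * t) (c • x)) :=
      ((h.contDiff_slice hct).differentiable (by simp)).comp (differentiable_id.const_smul c)
    intro x
    have e : FluidPDE.nsRescale c u t =
        fun y => c • (fun z : EuclideanSpace ℝ (Fin 3) => u (c ^ 2 * t) (c • z)) y := rfl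
    rw [e]
    simp only [VectorCalculus.divergence, fderiv_fun_const_smul (hdiff x) c,
      ContinuousLinearMap.toLinearMap_smul, map_smul, smul_eq_mul]
    have key := hd x
    simp only [VectorCalculus.divergence] at key
    rw [key, mul_zero]
  · have hst' : (0 : ℝ) + c ^ 2 * s < 0 + c ^ 2 * t := by nlinarith
    have ht' : (0 : ℝ) + c ^ 2 * t < 0 := by nlinarith
    have hu : ∀ X, u (0 + c ^ 2 * t) X =
        UnboundedOperators.heatExtension (u (0 + c ^ 2 * s)) (0 + c ^ 2 * t - (0 + c ^ 2 * s)) X -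
          oseenDuhamel 1 (0 + c ^ 2 * s) u u (0 + c ^ 2 * t) X :=
      fun X => h.mild_eq_heatExtension hst' ht' X
    have key := oseen_smul_stPull hc 0 (0 : EuclideanSpace ℝ (Fin 3)) hst hu x
    rw [nsRescale_eq_smul_stPull_zero, heatFlow_of_pos _ (sub_pos.2 hst)]
    exact key

/-- **The KNSS-gauge Type-I ancient mild class is invariant under space translations**
`u ↦ u(·, · + a)`, with the SAME constant `C` (Koch–Nadirashvili–Seregin–Šverák 2009, §1: the
symmetries of the problem): smoothness and the divergence condition are translation covariant
(`VectorCalculus.IsDivFree.comp_add_right`), the heat flow and the Oseen–Duhamel term commute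
with translations (`heatFlow_comp_add_right`, `oseenDuhamel_comp_add_right`), and the Type-I bound
is uniform in `x`. Word for word the route-cone `isTypeIAncientMild_comp_add_right` of
`Theorems/SymmetryModuliCountSymmetricLiouville.lean`. [cite: KochNadirashviliSereginSverak2009, §1 (1.2)] -/
theorem IsTypeIAncientMild.comp_add_right {C : ℝ}
    {u : ℝ → EuclideanSpace ℝ (Fin 3) → EuclideanSpace ℝ (Fin 3)} (h : IsTypeIAncientMild C u)
    (a : EuclideanSpace ℝ (Fin 3)) : IsTypeIAncientMild C (fun t x => u t (x + a)) := by
  refine ⟨?_, fun t ht => (h.isDivFree ht).comp_add_right a, fun s t hst ht x => ?_,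
    fun t ht x => h.norm_le ht (x + a)⟩
  · have e : (Function.uncurry fun t x => u t (x + a)) =
        Function.uncurry u ∘ fun p : ℝ × EuclideanSpace ℝ (Fin 3) => (p.1, p.2 + a) := by
      funext p
      rfl
    rw [e]
    refine h.contDiffOn.comp ((contDiff_fst.prodMk (contDiff_snd.add contDiff_const)).contDiffOn) ?_
    intro p hp
    exact mem_prod.2 ⟨(mem_prod.1 hp).1, mem_univ _⟩
  · show u t (x + a) = heatFlow (fun y => u s (y + a)) (t - s) x -
        oseenDuhamel 1 s (fun τ y => u τ (y + a)) (fun τ y => u τ (y + a)) t x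
    rw [heatFlow_comp_add_right, oseenDuhamel_comp_add_right]
    exact h.mild_eq hst ht (x + a)

end Literature.Analysis.FluidPDE

end
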